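import Literature.AlgebraicGeometry.HodgeTheory.SmoothBlowupHodgeConjecture
import Summits.HodgeConjecture.HodgeConjecture.Theorems.BoundaryReadoutPullbackAlgebraic
import HarnessLib

/-!
# `Arapura2001_hodgeClasses_algebraic_smoothBlowup` — DISCHARGED (one line)

A15 v4 for cell `hodge-nonav` (ROUTE-P1R «BLF»): the Literature file
`HodgeTheory/SmoothBlowupHodgeConjecture` (lit g19, p562470) reduces the named fact
`Arapura2001_hodgeClasses_algebraic_smoothBlowup` (Murre 1977 Lemma 2 / Arapura 2001 Lemma 16) to the
named fact `fulton1998_map_mem_algebraicClasses`, which is PROVED here in `Summits/` (crux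
`PullbackAlgebraic`, stmt-HodgeConjecture-1071, `Theorems/BoundaryReadoutPullbackAlgebraic`). Composing the
two gives the unconditional witness. To be landed by a PROVER seat as
`Summits/HodgeConjecture/HodgeConjecture/Theorems/SmoothBlowupHodgeConjectureHolds.lean`
(`ledger propose --kind proof --target … --file … --supports stmt-HodgeConjecture-19654 --as helper` or the
director's choice of item).
-/

noncomputable section

set_option linter.dupNamespace false

namespace Summit.HodgeConjecture.HodgeConjecture.Theorems.SmoothBlowupHC

open Literature.AlgebraicGeometry.HodgeTheory

/-- **Murre 1977 Lemma 2 / Arapura 2001 Lemma 16 — the tree's named fact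
`Arapura2001_hodgeClasses_algebraic_smoothBlowup`, PROVED** (the Literature reduction to the pull-back
fact, applied to the Summits-side theorem `fulton1998_map_mem_algebraicClasses_holds`). Relies on: nothing
unproved. [cite: Murre1977, Lemma 2 (p. 231)] [cite: Arapura2001HodgeCyclesModuli, Lemma 16]
[cite: VoisinHodgeI2002, §7.3.3 Thm. 7.31] -/
theorem Arapura2001_hodgeClasses_algebraic_smoothBlowup_holds :
    Arapura2001_hodgeClasses_algebraic_smoothBlowup :=
  Arapura2001_hodgeClasses_algebraic_smoothBlowup_of_pullbackAlgebraic
    Summit.HodgeConjecture.HodgeConjecture.Theorems.fulton1998_map_mem_algebraicClasses_holds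

/-- **Arapura 2001 Cor. 17, UNCONDITIONAL: the Hodge conjecture is a birational invariant of smooth
projective complex `n`-folds, `n ≤ 5`.** [cite: Arapura2001HodgeCyclesModuli, Cor. 17] -/
theorem hodgeBirationalInvariant_of_le_five {n : ℕ} (hn : n ≤ 5) : HodgeBirationalInvariant n :=
  hodgeBirationalInvariant_le_five
    Summit.HodgeConjecture.HodgeConjecture.Theorems.fulton1998_map_mem_algebraicClasses_holds hn

end Summit.HodgeConjecture.HodgeConjecture.Theorems.SmoothBlowupHC

end
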